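import Literature.NumberTheory.Sieve.MatomakiRadziwill
import Mathlib.Analysis.SpecialFunctions.Pow.Real
import HarnessLib

/-!
# Matomäki–Radziwiłł 2016, Lemma 4 (the Lipschitz estimate): reduction to the long-sum comparison

Topic `NumberTheory/Sieve`.  Lemma 4 of Matomäki–Radziwiłł (Ann. of Math. 183 (2016), §3; the named
fact `MatomakiRadziwill2016_lemma4` of `MatomakiRadziwill.lean`, one of the two remaining named-fact
inputs below `Literature.NumberTheory.Sieve.matomaki_radziwill`, parity.S38) compares a short average
`y⁻¹ ∑_{x ≤ n ≤ x+y} f(n)` (`x ∈ [X, 2X]`, `X/(log X)^{1/5} ≤ y ≤ X`) with the long average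
`X⁻¹ ∑_{X ≤ n ≤ 2X} f(n)`, with error `O((log X)^{-1/20})`.  Its printed proof consists of

1. the long-sum Lipschitz bound (eq. "Lipsch" of the paper): for `X/4 ≤ Y ≤ X`,
   `|X⁻¹ ∑_{n ≤ X} f(n) - Y⁻¹ ∑_{n ≤ Y} f(n)| ≪ (log X)^{-1/4}` — proved in the paper from Halász's
   theorem and Granville–Soundararajan [GS03] (vendored in
   `Literature/NumberTheory/LFunctions/GranvilleSoundararajan2003.lean`); recorded here as the named
   fact `MatomakiRadziwill2016_lemma4_lipschitz`;
2. "from which the claim follows easily" — **proved here**: `MatomakiRadziwill2016_lemma4_of_lipschitz`.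

The deduction: with `S(Z) = ∑_{n ≤ Z} f(n)` (`Ssum`), a window sum is `S(x+y) - S(⌈x⌉ - 1)`
(`sum_Icc_eq_Ssum_sub`); the bound at scale `3X` gives `S(Z) = Z μ + O(X (log X)^{-1/4})`,
`μ = S(3X)/(3X)`, for the four points `Z ∈ {x+y, ⌈x⌉-1, 2X, ⌈X⌉-1} ⊆ [3X/4, 3X]`; hence the window
average is `μ + O(1/y + (X/y)(log X)^{-1/4}) = μ + O((log X)^{1/5-1/4})` and the long average is
`μ + O((log X)^{-1/4})`, with `1/5 - 1/4 = -1/20`.  Constants: `C' = 2 + 12|C|`, `X₀' = max(X₀, e⁴)`.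

## References

* K. Matomäki, M. Radziwiłł, *Multiplicative functions in short intervals*, Ann. of Math. (2) 183
  (2016), 1015–1056, doi:10.4007/annals.2016.183.3.6 (arXiv:1501.04585), §3, Lemma 4 and its proof
  (arXiv pp. 9–10).
-/

noncomputable section

open Finset Filter Real

namespace Literature.NumberTheory.Sieve

/-- NAMED FACT — the **long-sum Lipschitz bound** inside the proof of Lemma 4 of Matomäki–Radziwiłł
(Ann. of Math. 183 (2016), §3, proof of Lemma 4, first display (eq. "Lipsch")), as printed: "We
shall show that, for any `X/4 ≤ Y ≤ X`,
`|X⁻¹ ∑_{n ≤ X} f(n) - Y⁻¹ ∑_{n ≤ Y} f(n)| ≪ (log X)^{-1/4}`, from which the claim follows easily."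
Here `f : ℕ → [-1,1]` is multiplicative (rendered as in `MatomakiRadziwill2016_lemma4`), the implied
constant is absolute and `X` is tacitly large (`∃ C X₀`); `∑_{n ≤ Z}` is `∑_{n ∈ Icc 1 ⌊Z⌋₊}`.  The
paper derives it from Halász's theorem and the results of Granville–Soundararajan [GS03]
(`Literature/NumberTheory/LFunctions/GranvilleSoundararajan2003.lean`); the deduction of Lemma 4 from
it ("follows easily") is `MatomakiRadziwill2016_lemma4_of_lipschitz` below.
Users take `(h : MatomakiRadziwill2016_lemma4_lipschitz)`.
[cite: MatomakiRadziwillAnnals2016, §3, proof of Lemma 4 (eq. Lipsch)] -/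
def MatomakiRadziwill2016_lemma4_lipschitz : Prop :=
  ∃ C X₀ : ℝ, ∀ f : ArithmeticFunction ℝ, f.IsMultiplicative → (∀ n, |f n| ≤ 1) →
    ∀ X Y : ℝ, X₀ ≤ X → X / 4 ≤ Y → Y ≤ X →
      |X⁻¹ * ∑ n ∈ Icc 1 ⌊X⌋₊, f n - Y⁻¹ * ∑ n ∈ Icc 1 ⌊Y⌋₊, f n| ≤ C / Real.log X ^ (1 / 4 : ℝ)

namespace MatomakiRadziwillL4

/-- The summatory function `S(Z) = ∑_{n ≤ Z} f(n)`. [folklore] -/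
def Ssum (f : ℕ → ℝ) (Z : ℝ) : ℝ := ∑ n ∈ Icc 1 ⌊Z⌋₊, f n

/-- `|S(Z)| ≤ Z` for `|f| ≤ 1`. [folklore] -/
theorem abs_Ssum_le {f : ℕ → ℝ} (hf : ∀ n, |f n| ≤ 1) {Z : ℝ} (hZ : 0 ≤ Z) : |Ssum f Z| ≤ Z := by
  unfold Ssum
  calc |∑ n ∈ Icc 1 ⌊Z⌋₊, f n| ≤ ∑ n ∈ Icc 1 ⌊Z⌋₊, |f n| := Finset.abs_sum_le_sum_abs _ _
    _ ≤ ∑ n ∈ Icc 1 ⌊Z⌋₊, (1 : ℝ) := Finset.sum_le_sum fun n _ => hf n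
    _ = ⌊Z⌋₊ := by simp
    _ ≤ Z := Nat.floor_le hZ

/-- A window sum is a difference of two values of `S`: `∑_{x ≤ n ≤ x+y} f(n) = S(x+y) - S(⌈x⌉ - 1)`. [folklore] -/
theorem sum_Icc_eq_Ssum_sub {f : ℕ → ℝ} {x y : ℝ} (hx : 1 ≤ x) (hy : 0 ≤ y) :
    ∑ n ∈ Icc ⌈x⌉₊ ⌊x + y⌋₊, f n = Ssum f (x + y) - Ssum f ((⌈x⌉₊ - 1 : ℕ) : ℝ) := by
  unfold Ssum
  rw [Nat.floor_natCast]
  have h1 : 1 ≤ ⌈x⌉₊ := Nat.one_le_iff_ne_zero.2 (by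
    intro h; rw [Nat.ceil_eq_zero] at h; linarith)
  have h2 : ⌈x⌉₊ - 1 ≤ ⌊x + y⌋₊ := by
    have h3 : (⌈x⌉₊ : ℝ) < x + 1 := Nat.ceil_lt_add_one (by linarith)
    have h4 : x + y < ⌊x + y⌋₊ + 1 := Nat.lt_floor_add_one _
    have h5 : (⌈x⌉₊ : ℝ) < (⌊x + y⌋₊ : ℝ) + 2 := by linarith
    have h6 : ⌈x⌉₊ < ⌊x + y⌋₊ + 2 := by exact_mod_cast h5
    omega
  rw [eq_sub_iff_add_eq, ← Finset.sum_union]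
  · congr 1
    ext n
    simp only [Finset.mem_union, Finset.mem_Icc]
    omega
  · rw [Finset.disjoint_left]
    intro n hn hn'
    simp only [Finset.mem_Icc] at hn hn'
    omega

/-- `S` at the integer point `⌈x⌉ - 1 ∈ [x - 1, x)`. [folklore] -/
theorem pred_ceil_bounds {x : ℝ} (hx : 1 ≤ x) :
    x - 1 ≤ ((⌈x⌉₊ - 1 : ℕ) : ℝ) ∧ ((⌈x⌉₊ - 1 : ℕ) : ℝ) ≤ x := by
  have h1 : 1 ≤ ⌈x⌉₊ := Nat.one_le_iff_ne_zero.2 (by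
    intro h; rw [Nat.ceil_eq_zero] at h; linarith)
  rw [Nat.cast_sub h1, Nat.cast_one]
  constructor
  · linarith [Nat.le_ceil x]
  · have := Nat.ceil_lt_add_one (by linarith : 0 ≤ x); linarith

/-- **Lemma 4 from the long-sum Lipschitz bound** ("from which the claim follows easily"): apply the
bound at scale `3X` to `Z ∈ {x + y, ⌈x⌉ - 1, 2X, ⌈X⌉ - 1} ⊆ [3X/4, 3X]`, so that each `S(Z) = Zμ + O(X (log X)^{-1/4})`
with `μ = S(3X)/(3X)`; the window average is `μ + O((X/y)(log X)^{-1/4}) = μ + O((log X)^{-1/20})` and the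
long average over `[X, 2X]` is `μ + O((log X)^{-1/4})`.
[cite: MatomakiRadziwillAnnals2016, §3, proof of Lemma 4] -/
theorem lemma4_of_lipschitz (h : MatomakiRadziwill2016_lemma4_lipschitz) :
    MatomakiRadziwill2016_lemma4 := by
  obtain ⟨C, X₀, H⟩ := h
  refine ⟨2 + 12 * |C|, max X₀ (Real.exp 4), ?_⟩
  intro f hf hf1 X x y hX hXx hx2 hyl hyX
  have hX₀ : X₀ ≤ X := (le_max_left _ _).trans hX
  have hXe : Real.exp 4 ≤ X := (le_max_right _ _).trans hX
  have hX4 : 4 ≤ X := by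
    have := Real.add_one_le_exp (4 : ℝ); linarith
  have hX0 : 0 < X := by linarith
  set ℓ := Real.log X with hℓ
  have hℓ4 : 4 ≤ ℓ := by
    rw [hℓ, ← Real.log_exp 4]; exact Real.log_le_log (Real.exp_pos 4) hXe
  have hℓ1 : 1 ≤ ℓ := by linarith
  have hℓ0 : 0 < ℓ := by linarith
  have hℓX : ℓ ≤ X := by
    have := Real.log_le_sub_one_of_pos hX0; rw [hℓ]; linarith
  have hℓ5 : 1 ≤ ℓ ^ (1 / 5 : ℝ) := Real.one_le_rpow hℓ1 (by norm_num)
  have hy0 : 0 < y := lt_of_lt_of_le (div_pos hX0 (by linarith)) hyl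
  have hf1' : ∀ n, |(f : ℕ → ℝ) n| ≤ 1 := hf1
  -- the comparison scale `3X` and the four points
  have h3X : X₀ ≤ 3 * X := by linarith
  set μ := (3 * X)⁻¹ * Ssum f (3 * X) with hμ
  have hμ1 : |μ| ≤ 1 := by
    rw [hμ, abs_mul, abs_inv, abs_of_pos (by linarith : (0:ℝ) < 3 * X)]
    have := abs_Ssum_le hf1' (by linarith : (0:ℝ) ≤ 3 * X)
    rw [inv_mul_le_iff₀ (by linarith)]; linarith
  have hE : ∀ Z : ℝ, 3 * X / 4 ≤ Z → Z ≤ 3 * X → |Ssum f Z - Z * μ| ≤ 3 * |C| * X / ℓ ^ (1 / 4 : ℝ) := by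
    intro Z hZ1 hZ2
    have hZ0 : 0 < Z := by linarith
    have key := H f hf hf1 (3 * X) Z h3X hZ1 hZ2
    change |(3 * X)⁻¹ * Ssum f (3 * X) - Z⁻¹ * Ssum f Z| ≤ C / Real.log (3 * X) ^ (1 / 4 : ℝ) at key
    rw [← hμ] at key
    have hlog : ℓ ^ (1 / 4 : ℝ) ≤ Real.log (3 * X) ^ (1 / 4 : ℝ) :=
      Real.rpow_le_rpow hℓ0.le (Real.log_le_log hX0 (by linarith)) (by norm_num)
    have hlog0 : 0 < Real.log (3 * X) := Real.log_pos (by linarith)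
    have hC : C / Real.log (3 * X) ^ (1 / 4 : ℝ) ≤ |C| / ℓ ^ (1 / 4 : ℝ) :=
      (div_le_div_of_nonneg_right (le_abs_self C) (Real.rpow_nonneg hlog0.le _)).trans
        (div_le_div_of_nonneg_left (abs_nonneg C) (Real.rpow_pos_of_pos hℓ0 _) hlog)
    have e : Ssum f Z - Z * μ = -Z * (μ - Z⁻¹ * Ssum f Z) := by field_simp; ring
    rw [e, abs_mul, abs_neg, abs_of_pos hZ0]
    calc Z * |μ - Z⁻¹ * Ssum f Z| ≤ (3 * X) * (|C| / ℓ ^ (1 / 4 : ℝ)) :=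
          mul_le_mul hZ2 (key.trans hC) (abs_nonneg _) (by linarith)
      _ = 3 * |C| * X / ℓ ^ (1 / 4 : ℝ) := by ring
  set E := 3 * |C| * X / ℓ ^ (1 / 4 : ℝ) with hEdef
  have hE0 : 0 ≤ E := by positivity
  -- the window average
  obtain ⟨hp1, hp2⟩ := pred_ceil_bounds (by linarith : (1:ℝ) ≤ x)
  set Z₂ : ℝ := ((⌈x⌉₊ - 1 : ℕ) : ℝ)
  have hwin : |y⁻¹ * ∑ n ∈ Icc ⌈x⌉₊ ⌊x + y⌋₊, f n - μ| ≤ y⁻¹ * (1 + 2 * E) := by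
    rw [sum_Icc_eq_Ssum_sub (by linarith) hy0.le]
    have e1 := hE (x + y) (by linarith) (by linarith)
    have e2 := hE Z₂ (by linarith) (by linarith)
    have e : y⁻¹ * (Ssum f (x + y) - Ssum f Z₂) - μ
        = y⁻¹ * ((Ssum f (x + y) - (x + y) * μ) - (Ssum f Z₂ - Z₂ * μ) + (x - Z₂) * μ) := by
      field_simp; ring
    rw [e, abs_mul, abs_of_pos (inv_pos.2 hy0)]
    refine mul_le_mul_of_nonneg_left ?_ (inv_pos.2 hy0).le
    refine (abs_add_le _ _).trans ((add_le_add (abs_sub _ _) le_rfl).trans ?_)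
    rw [abs_mul]
    have : |x - Z₂| * |μ| ≤ 1 * 1 := mul_le_mul (by rw [abs_le]; constructor <;> linarith) hμ1 (abs_nonneg _) zero_le_one
    linarith
  -- the long average
  obtain ⟨hq1, hq2⟩ := pred_ceil_bounds (by linarith : (1:ℝ) ≤ X)
  set Z₄ : ℝ := ((⌈X⌉₊ - 1 : ℕ) : ℝ)
  have hlong : |X⁻¹ * ∑ n ∈ Icc ⌈X⌉₊ ⌊2 * X⌋₊, f n - μ| ≤ X⁻¹ * (1 + 2 * E) := by
    have := sum_Icc_eq_Ssum_sub (f := f) (x := X) (y := X) (by linarith) hX0.le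
    rw [show X + X = 2 * X by ring] at this
    rw [this]
    have e1 := hE (2 * X) (by linarith) (by linarith)
    have e2 := hE Z₄ (by linarith) (by linarith)
    have e : X⁻¹ * (Ssum f (2 * X) - Ssum f Z₄) - μ
        = X⁻¹ * ((Ssum f (2 * X) - (2 * X) * μ) - (Ssum f Z₄ - Z₄ * μ) + (X - Z₄) * μ) := by
      field_simp; ring
    rw [e, abs_mul, abs_of_pos (inv_pos.2 hX0)]
    refine mul_le_mul_of_nonneg_left ?_ (inv_pos.2 hX0).le
    refine (abs_add_le _ _).trans ((add_le_add (abs_sub _ _) le_rfl).trans ?_)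
    rw [abs_mul]
    have : |X - Z₄| * |μ| ≤ 1 * 1 := mul_le_mul (by rw [abs_le]; constructor <;> linarith) hμ1 (abs_nonneg _) zero_le_one
    linarith
  -- combine
  have hyinv : y⁻¹ ≤ ℓ ^ (1 / 5 : ℝ) / X := by
    rw [inv_le_comm₀ hy0 (by positivity), inv_div]; exact hyl
  have hXinv : X⁻¹ ≤ ℓ ^ (1 / 5 : ℝ) / X := by
    rw [inv_eq_one_div]; exact div_le_div_of_nonneg_right hℓ5 hX0.le
  have htot : |y⁻¹ * ∑ n ∈ Icc ⌈x⌉₊ ⌊x + y⌋₊, f n - X⁻¹ * ∑ n ∈ Icc ⌈X⌉₊ ⌊2 * X⌋₊, f n|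
      ≤ 2 * (ℓ ^ (1 / 5 : ℝ) / X) * (1 + 2 * E) := by
    have := abs_sub_le (y⁻¹ * ∑ n ∈ Icc ⌈x⌉₊ ⌊x + y⌋₊, f n) μ (X⁻¹ * ∑ n ∈ Icc ⌈X⌉₊ ⌊2 * X⌋₊, f n)
    rw [abs_sub_comm μ] at this
    have h12 : 0 ≤ 1 + 2 * E := by positivity
    nlinarith [mul_le_mul_of_nonneg_right hyinv h12, mul_le_mul_of_nonneg_right hXinv h12]
  refine htot.trans ?_
  -- `2 ℓ^{1/5}/X (1 + 2E) = 2ℓ^{1/5}/X + 12|C| ℓ^{1/5}/ℓ^{1/4} ≤ (2 + 12|C|)/ℓ^{1/20}`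
  have hpow : ℓ ^ (1 / 5 : ℝ) / ℓ ^ (1 / 4 : ℝ) = 1 / ℓ ^ (1 / 20 : ℝ) := by
    rw [div_eq_div_iff (by positivity) (by positivity), one_mul, ← Real.rpow_add hℓ0]; norm_num
  have h1 : 2 * (ℓ ^ (1 / 5 : ℝ) / X) * (1 + 2 * E) = 2 * (ℓ ^ (1 / 5 : ℝ) / X) + 12 * |C| * (1 / ℓ ^ (1 / 20 : ℝ)) := by
    rw [← hpow, hEdef]; field_simp; ring
  have h2 : ℓ ^ (1 / 5 : ℝ) / X ≤ 1 / ℓ ^ (1 / 20 : ℝ) := by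
    rw [div_le_div_iff₀ hX0 (by positivity), one_mul, ← Real.rpow_add hℓ0]
    calc ℓ ^ ((1 / 5 : ℝ) + 1 / 20) ≤ ℓ ^ (1 : ℝ) := Real.rpow_le_rpow_of_exponent_le hℓ1 (by norm_num)
      _ = ℓ := Real.rpow_one ℓ
      _ ≤ X := hℓX
  rw [h1]
  have h3 : 0 ≤ 1 / ℓ ^ (1 / 20 : ℝ) := by positivity
  calc 2 * (ℓ ^ (1 / 5 : ℝ) / X) + 12 * |C| * (1 / ℓ ^ (1 / 20 : ℝ))
      ≤ 2 * (1 / ℓ ^ (1 / 20 : ℝ)) + 12 * |C| * (1 / ℓ ^ (1 / 20 : ℝ)) := by gcongr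
    _ = (2 + 12 * |C|) / ℓ ^ (1 / 20 : ℝ) := by ring


end MatomakiRadziwillL4

/-- **Matomäki–Radziwiłł 2016, Lemma 4 from the long-sum Lipschitz bound** (paper-facing name; the
"follows easily" step of the printed proof, proved). [cite: MatomakiRadziwillAnnals2016, §3, proof of Lemma 4] -/
theorem MatomakiRadziwill2016_lemma4_of_lipschitz (h : MatomakiRadziwill2016_lemma4_lipschitz) :
    MatomakiRadziwill2016_lemma4 :=
  MatomakiRadziwillL4.lemma4_of_lipschitz h

end Literature.NumberTheory.Sieve
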